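import Literature.NumberTheory.EllipticCurves.TwoDescentLinearConditions
import Literature.Barriers.BirchSwinnertonDyer.RankNotSumOfLocalInvariantsF4TwistPoints
import Mathlib.Tactic.NormNum.Prime
import HarnessLib

/-!
# Wiman's congruent number curve `E₂₉₂₇₄ : y² = x³ - 29274²x` has four independent rational points

`n = 29274 = 2·3·7·17·41`. The congruent number curve `E_n : y² = x³ - n²x` (tree
`congruentNumberCurve 29274`, full rational `2`-torsion `(-n, 0), (0, 0), (n, 0)`) carries the
rational points `P₁ = (-4998, 2039184)`, `P₂ = (-6027, 2223963)`, `P₃ = (156282, 60688656)`,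
`P₄ = (-1926688218/257², 7127347971744/257³)` (Wiman, Acta Math. 77 (1945): a congruent
number curve of rank `4`; the object c1:G-RN-09 of the Goldfeld census — Goldfeld's own example,
Ann. Sc. Norm. Sup. Pisa (4) 3 (1976), p. 626 «The only curve that seems to be known with rank
`g ≥ 4` and complex multiplication is the example given by Wiman [24]», printed there with a
spurious factor `11` [sic, ruling G-8]; see the companion file
`CongruentNumberCurve29274.lean`). This file PROVES

* `four_le_mordellWeilRank` — **`4 ≤ rank_ℤ E₂₉₂₇₄(ℚ)`**: the complete `2`-descent map
  `δ(P) = (x + n, x) ∈ (ℚ*/ℚ*²)²` (Silverman AEC Prop. X.1.4; tree `twoDescentMap`, kernel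
  `2E(ℚ)`) followed by the six quadratic characters
  `ψ = (v₂, v₃, v₇, v₁₇ of x + n; sign, v₁₇ of x) (mod 2)` takes `𝔽₂`-linearly independent
  values on `P₁, …, P₄` and the torsion points `T₁ = (-n, 0)`, `T₂ = (0, 0)` (a `6 × 6` matrix
  of rank `6` over `𝔽₂`, checked by `decide`), so `P₁, …, P₄` are `ℤ`-independent (tree
  `TwoDescentLocal.le_mordellWeilRank_of_twoTorsion'`, which includes the Mordell–Weil theorem).

The upper bound `rank ≤ 4` (PARI `ellrank` `[4, 4]`) is NOT proved here: the Goldfeld chain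
consumes lower bounds only. The descent data were found outside Lean (Goldfeld census,
census-1 gen3, `cert_rank4_29274.py`, images `(-2·3·17, -2·7·17), (-3·41, -3·7), (2·3·7, 2),
(-2·3·7, -3·7)` of `P₁..P₄` under `(x, x - n)`); every claim is re-verified by the kernel, in the
format of `Literature/Barriers/BirchSwinnertonDyer/RankNotSumOfLocalInvariantsCNRanksB.lean`.

## References

* [SilvermanAEC2009] J. H. Silverman, *The Arithmetic of Elliptic Curves*, 2nd ed., GTM 106,
  Prop. X.1.4 (complete `2`-descent), Example X.1.5.
* [Goldfeld1976] D. Goldfeld, Ann. Sc. Norm. Sup. Pisa (4) 3 (1976) 623–663, p. 626.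
-/

noncomputable section

open scoped Classical

namespace Literature.NumberTheory.EllipticCurves.CongruentNumber29274

open _root_.WeierstrassCurve _root_.WeierstrassCurve.Affine _root_.WeierstrassCurve.Affine.Point
open Literature.NumberTheory.EllipticCurves.KramerTwoDescent
open Literature.NumberTheory.EllipticCurves.TwoDescentLocal
open Literature.Barriers.BirchSwinnertonDyer.DokchitserDokchitser2011

/-- `7` is prime (instance for `parityHom 7`). [folklore] -/
instance fact_prime_7 : Fact (Nat.Prime 7) := ⟨by norm_num⟩

/-- `17` is prime (instance for `parityHom 17`). [folklore] -/
instance fact_prime_17 : Fact (Nat.Prime 17) := ⟨by norm_num⟩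

/-- Wiman's curve `E₂₉₂₇₄ = congruentNumberCurve 29274 : y² = x³ - 29274²x`. [folklore] -/
abbrev E : WeierstrassCurve ℚ := congruentNumberCurve 29274

/-- `E₂₉₂₇₄` is an elliptic curve (`Δ = 64·29274⁶ ≠ 0`). [folklore] -/
instance : (E).IsElliptic := isElliptic_congruentNumberCurve (by norm_num)

/-- Rational `2`-torsion abscissae `-29274, 0, 29274`. [folklore] -/
private theorem hsplit : (E).toAffine.SplitTwoTorsion (-29274) 0 29274 := by
  have h := splitTwoTorsion_cn 29274
  norm_num at h
  exact h

section Descent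

/-- The six quadratic characters of the `2`-descent used for the lower bound:
`(v₂, v₃, v₇, v₁₇)(x + 29274)` and `(sign, v₁₇)(x)`, mod `2` (Silverman AEC Prop. X.1.4).
[folklore] -/
def ψ : (E).toAffine.Point →+ (Fin 6 → ZMod 2) :=
  AddMonoidHom.pi fun i => (![charFst hsplit (parityHom 2), charFst hsplit (parityHom 3),
    charFst hsplit (parityHom 7), charFst hsplit (parityHom 17), charSnd hsplit signHom,
    charSnd hsplit (parityHom 17)] : Fin 6 → ((E).toAffine.Point →+ ZMod 2)) i

/-- `ψ` on an affine point off the `2`-torsion. [folklore] -/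
private theorem ψ_some {x y : ℚ} (hP : (E).toAffine.Nonsingular x y) (hx₁ : x ≠ -29274)
    (hx₂ : x ≠ 0) :
    ψ (.some x y hP) = ![parityBit 2 (x - -29274), parityBit 3 (x - -29274),
      parityBit 7 (x - -29274), parityBit 17 (x - -29274), signBit (x - 0),
      parityBit 17 (x - 0)] := by
  have hx₁' : x - -29274 ≠ 0 := sub_ne_zero.mpr hx₁
  have hx₂' : x - 0 ≠ 0 := sub_ne_zero.mpr hx₂
  ext i
  fin_cases i
  · show charFst hsplit (parityHom 2) (.some x y hP) = parityBit 2 (x - -29274)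
    rw [charFst_apply, twoDescentComponent_some_of_ne hP hx₁, parityHom_sqClass hx₁']
  · show charFst hsplit (parityHom 3) (.some x y hP) = parityBit 3 (x - -29274)
    rw [charFst_apply, twoDescentComponent_some_of_ne hP hx₁, parityHom_sqClass hx₁']
  · show charFst hsplit (parityHom 7) (.some x y hP) = parityBit 7 (x - -29274)
    rw [charFst_apply, twoDescentComponent_some_of_ne hP hx₁, parityHom_sqClass hx₁']
  · show charFst hsplit (parityHom 17) (.some x y hP) = parityBit 17 (x - -29274)
    rw [charFst_apply, twoDescentComponent_some_of_ne hP hx₁, parityHom_sqClass hx₁']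
  · show charSnd hsplit signHom (.some x y hP) = signBit (x - 0)
    rw [charSnd_apply, twoDescentComponent_some_of_ne hP hx₂, signHom_sqClass hx₂']
  · show charSnd hsplit (parityHom 17) (.some x y hP) = parityBit 17 (x - 0)
    rw [charSnd_apply, twoDescentComponent_some_of_ne hP hx₂, parityHom_sqClass hx₂']

/-- `ψ(T₁)` for `T₁ = (-29274, 0)`: `δ(T₁) = (2·29274², -29274)`. [folklore] -/
private theorem ψ_T1 : ψ (.some _ _ (nonsingular_twoTorsion hsplit)) = ![1, 0, 0, 0, 1, 1] := by
  have h₁ : (((-29274 : ℚ) - 0) * ((-29274 : ℚ) - 29274)) ≠ 0 := by norm_num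
  have h₂ : ((-29274 : ℚ) - 0) ≠ 0 := by norm_num
  ext i
  fin_cases i
  · show charFst hsplit (parityHom 2) _ = 1
    rw [charFst_apply, twoDescentComponent_some_of_eq _ rfl, parityHom_sqClass h₁]
    exact parityBit_eq_of_eq 2 3 (u := 214241769) (v := 1) (1) (Or.inl rfl) (by norm_num)
      (by norm_num) (by norm_num)
  · show charFst hsplit (parityHom 3) _ = 0
    rw [charFst_apply, twoDescentComponent_some_of_eq _ rfl, parityHom_sqClass h₁]
    exact parityBit_eq_of_eq 3 2 (u := 190437128) (v := 1) (1) (Or.inl rfl) (by norm_num)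
      (by norm_num) (by norm_num)
  · show charFst hsplit (parityHom 7) _ = 0
    rw [charFst_apply, twoDescentComponent_some_of_eq _ rfl, parityHom_sqClass h₁]
    exact parityBit_eq_of_eq 7 2 (u := 34978248) (v := 1) (1) (Or.inl rfl) (by norm_num)
      (by norm_num) (by norm_num)
  · show charFst hsplit (parityHom 17) _ = 0
    rw [charFst_apply, twoDescentComponent_some_of_eq _ rfl, parityHom_sqClass h₁]
    exact parityBit_eq_of_eq 17 2 (u := 5930568) (v := 1) (1) (Or.inl rfl) (by norm_num)
      (by norm_num) (by norm_num)
  · show charSnd hsplit signHom _ = 1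
    rw [charSnd_apply, twoDescentComponent_some_of_ne _ (by norm_num), signHom_sqClass h₂]
    exact signBit_of_neg (by norm_num)
  · show charSnd hsplit (parityHom 17) _ = 1
    rw [charSnd_apply, twoDescentComponent_some_of_ne _ (by norm_num), parityHom_sqClass h₂]
    exact parityBit_eq_of_eq 17 1 (u := 1722) (v := 1) (-1) (Or.inr rfl) (by norm_num)
      (by norm_num) (by norm_num)

/-- `ψ(T₂)` for `T₂ = (0, 0)`: `δ(T₂) = (29274, -29274²)`. [folklore] -/
private theorem ψ_T2 :
    ψ (.some _ _ (nonsingular_twoTorsion hsplit.swap₁₂)) = ![1, 1, 1, 1, 1, 0] := by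
  have h₁ : ((0 : ℚ) - -29274) ≠ 0 := by norm_num
  have h₂ : (((0 : ℚ) - -29274) * ((0 : ℚ) - 29274)) ≠ 0 := by norm_num
  ext i
  fin_cases i
  · show charFst hsplit (parityHom 2) _ = 1
    rw [charFst_apply, twoDescentComponent_some_of_ne _ (by norm_num), parityHom_sqClass h₁]
    exact parityBit_eq_of_eq 2 1 (u := 14637) (v := 1) (1) (Or.inl rfl) (by norm_num)
      (by norm_num) (by norm_num)
  · show charFst hsplit (parityHom 3) _ = 1
    rw [charFst_apply, twoDescentComponent_some_of_ne _ (by norm_num), parityHom_sqClass h₁]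
    exact parityBit_eq_of_eq 3 1 (u := 9758) (v := 1) (1) (Or.inl rfl) (by norm_num)
      (by norm_num) (by norm_num)
  · show charFst hsplit (parityHom 7) _ = 1
    rw [charFst_apply, twoDescentComponent_some_of_ne _ (by norm_num), parityHom_sqClass h₁]
    exact parityBit_eq_of_eq 7 1 (u := 4182) (v := 1) (1) (Or.inl rfl) (by norm_num)
      (by norm_num) (by norm_num)
  · show charFst hsplit (parityHom 17) _ = 1
    rw [charFst_apply, twoDescentComponent_some_of_ne _ (by norm_num), parityHom_sqClass h₁]
    exact parityBit_eq_of_eq 17 1 (u := 1722) (v := 1) (1) (Or.inl rfl) (by norm_num)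
      (by norm_num) (by norm_num)
  · show charSnd hsplit signHom _ = 1
    rw [charSnd_apply, twoDescentComponent_some_of_eq _ rfl, signHom_sqClass h₂]
    exact signBit_of_neg (by norm_num)
  · show charSnd hsplit (parityHom 17) _ = 0
    rw [charSnd_apply, twoDescentComponent_some_of_eq _ rfl, parityHom_sqClass h₂]
    exact parityBit_eq_of_eq 17 2 (u := 2965284) (v := 1) (-1) (Or.inr rfl) (by norm_num)
      (by norm_num) (by norm_num)

/-- `ψ(T₃)` for `T₃ = (29274, 0)`: `δ(T₃) = (2·29274, 29274) = δ(T₁)δ(T₂)`. [folklore] -/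
private theorem ψ_T3 :
    ψ (.some _ _ (nonsingular_twoTorsion hsplit.swap₂₃.swap₁₂)) = ![0, 1, 1, 1, 0, 1] := by
  have h₁ : ((29274 : ℚ) - -29274) ≠ 0 := by norm_num
  have h₂ : ((29274 : ℚ) - 0) ≠ 0 := by norm_num
  ext i
  fin_cases i
  · show charFst hsplit (parityHom 2) _ = 0
    rw [charFst_apply, twoDescentComponent_some_of_ne _ (by norm_num), parityHom_sqClass h₁]
    exact parityBit_eq_of_eq 2 2 (u := 14637) (v := 1) (1) (Or.inl rfl) (by norm_num)
      (by norm_num) (by norm_num)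
  · show charFst hsplit (parityHom 3) _ = 1
    rw [charFst_apply, twoDescentComponent_some_of_ne _ (by norm_num), parityHom_sqClass h₁]
    exact parityBit_eq_of_eq 3 1 (u := 19516) (v := 1) (1) (Or.inl rfl) (by norm_num)
      (by norm_num) (by norm_num)
  · show charFst hsplit (parityHom 7) _ = 1
    rw [charFst_apply, twoDescentComponent_some_of_ne _ (by norm_num), parityHom_sqClass h₁]
    exact parityBit_eq_of_eq 7 1 (u := 8364) (v := 1) (1) (Or.inl rfl) (by norm_num)
      (by norm_num) (by norm_num)
  · show charFst hsplit (parityHom 17) _ = 1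
    rw [charFst_apply, twoDescentComponent_some_of_ne _ (by norm_num), parityHom_sqClass h₁]
    exact parityBit_eq_of_eq 17 1 (u := 3444) (v := 1) (1) (Or.inl rfl) (by norm_num)
      (by norm_num) (by norm_num)
  · show charSnd hsplit signHom _ = 0
    rw [charSnd_apply, twoDescentComponent_some_of_ne _ (by norm_num), signHom_sqClass h₂]
    exact signBit_of_nonneg (by norm_num)
  · show charSnd hsplit (parityHom 17) _ = 1
    rw [charSnd_apply, twoDescentComponent_some_of_ne _ (by norm_num), parityHom_sqClass h₂]
    exact parityBit_eq_of_eq 17 1 (u := 1722) (v := 1) (1) (Or.inl rfl) (by norm_num)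
      (by norm_num) (by norm_num)

end Descent

section Points

/-- Wiman's point `P₁ = (-4998, 2039184)` on `E₂₉₂₇₄`. [folklore] -/
def P₁ : (E).toAffine.Point :=
  .some (-4998 : ℚ) (2039184 : ℚ) ((cn_nonsingular_iff (n := 29274) (by norm_num) _ _).mpr
    (by norm_num))

/-- Wiman's point `P₂ = (-6027, 2223963)` on `E₂₉₂₇₄`. [folklore] -/
def P₂ : (E).toAffine.Point :=
  .some (-6027 : ℚ) (2223963 : ℚ) ((cn_nonsingular_iff (n := 29274) (by norm_num) _ _).mpr
    (by norm_num))

/-- Wiman's point `P₃ = (156282, 60688656)` on `E₂₉₂₇₄`. [folklore] -/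
def P₃ : (E).toAffine.Point :=
  .some (156282 : ℚ) (60688656 : ℚ) ((cn_nonsingular_iff (n := 29274) (by norm_num) _ _).mpr
    (by norm_num))

/-- The point `P₄ = (-1926688218/257², 7127347971744/257³)` on `E₂₉₂₇₄`. [folklore] -/
def P₄ : (E).toAffine.Point :=
  .some ((-1926688218 : ℚ) / 66049) ((7127347971744 : ℚ) / 16974593)
    ((cn_nonsingular_iff (n := 29274) (by norm_num) _ _).mpr (by norm_num))

/-- `ψ(P₁)`: `x + n = 2²·3·7·17²`, `x = -2·3·7²·17`. [folklore] -/
private theorem ψ_P₁ : ψ P₁ = ![0, 1, 1, 0, 1, 1] := by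
  rw [P₁, ψ_some _ (by norm_num) (by norm_num)]
  ext i
  fin_cases i
  · show parityBit 2 _ = 0
    exact parityBit_eq_of_eq 2 2 (u := 6069) (v := 1) (1) (Or.inl rfl) (by norm_num)
      (by norm_num) (by norm_num)
  · show parityBit 3 _ = 1
    exact parityBit_eq_of_eq 3 1 (u := 8092) (v := 1) (1) (Or.inl rfl) (by norm_num)
      (by norm_num) (by norm_num)
  · show parityBit 7 _ = 1
    exact parityBit_eq_of_eq 7 1 (u := 3468) (v := 1) (1) (Or.inl rfl) (by norm_num)
      (by norm_num) (by norm_num)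
  · show parityBit 17 _ = 0
    exact parityBit_eq_of_eq 17 2 (u := 84) (v := 1) (1) (Or.inl rfl) (by norm_num)
      (by norm_num) (by norm_num)
  · show signBit _ = 1
    exact signBit_of_neg (by norm_num)
  · show parityBit 17 _ = 1
    exact parityBit_eq_of_eq 17 1 (u := 294) (v := 1) (-1) (Or.inr rfl) (by norm_num)
      (by norm_num) (by norm_num)

/-- `ψ(P₂)`: `x + n = 3⁴·7·41`, `x = -3·7²·41`. [folklore] -/
private theorem ψ_P₂ : ψ P₂ = ![0, 0, 1, 0, 1, 0] := by
  rw [P₂, ψ_some _ (by norm_num) (by norm_num)]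
  ext i
  fin_cases i
  · show parityBit 2 _ = 0
    exact parityBit_eq_of_eq 2 0 (u := 23247) (v := 1) (1) (Or.inl rfl) (by norm_num)
      (by norm_num) (by norm_num)
  · show parityBit 3 _ = 0
    exact parityBit_eq_of_eq 3 4 (u := 287) (v := 1) (1) (Or.inl rfl) (by norm_num)
      (by norm_num) (by norm_num)
  · show parityBit 7 _ = 1
    exact parityBit_eq_of_eq 7 1 (u := 3321) (v := 1) (1) (Or.inl rfl) (by norm_num)
      (by norm_num) (by norm_num)
  · show parityBit 17 _ = 0
    exact parityBit_eq_of_eq 17 0 (u := 23247) (v := 1) (1) (Or.inl rfl) (by norm_num)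
      (by norm_num) (by norm_num)
  · show signBit _ = 1
    exact signBit_of_neg (by norm_num)
  · show parityBit 17 _ = 0
    exact parityBit_eq_of_eq 17 0 (u := 6027) (v := 1) (-1) (Or.inr rfl) (by norm_num)
      (by norm_num) (by norm_num)

/-- `ψ(P₃)`: `x + n = 2²·3·7·47²`, `x = 2·3·7·61²`. [folklore] -/
private theorem ψ_P₃ : ψ P₃ = ![0, 1, 1, 0, 0, 0] := by
  rw [P₃, ψ_some _ (by norm_num) (by norm_num)]
  ext i
  fin_cases i
  · show parityBit 2 _ = 0
    exact parityBit_eq_of_eq 2 2 (u := 46389) (v := 1) (1) (Or.inl rfl) (by norm_num)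
      (by norm_num) (by norm_num)
  · show parityBit 3 _ = 1
    exact parityBit_eq_of_eq 3 1 (u := 61852) (v := 1) (1) (Or.inl rfl) (by norm_num)
      (by norm_num) (by norm_num)
  · show parityBit 7 _ = 1
    exact parityBit_eq_of_eq 7 1 (u := 26508) (v := 1) (1) (Or.inl rfl) (by norm_num)
      (by norm_num) (by norm_num)
  · show parityBit 17 _ = 0
    exact parityBit_eq_of_eq 17 0 (u := 185556) (v := 1) (1) (Or.inl rfl) (by norm_num)
      (by norm_num) (by norm_num)
  · show signBit _ = 0
    exact signBit_of_nonneg (by norm_num)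
  · show parityBit 17 _ = 0
    exact parityBit_eq_of_eq 17 0 (u := 156282) (v := 1) (1) (Or.inl rfl) (by norm_num)
      (by norm_num) (by norm_num)

/-- `ψ(P₄)`: `x + n = 2⁷·231²/257²`, `x = -2·3·7·6773²/257²`. [folklore] -/
private theorem ψ_P₄ : ψ P₄ = ![1, 0, 0, 0, 1, 0] := by
  rw [P₄, ψ_some _ (by norm_num) (by norm_num)]
  ext i
  fin_cases i
  · show parityBit 2 _ = 1
    exact parityBit_eq_of_eq 2 7 (u := 53361) (v := 66049) (1) (Or.inl rfl) (by norm_num)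
      (by norm_num) (by norm_num)
  · show parityBit 3 _ = 0
    exact parityBit_eq_of_eq 3 2 (u := 758912) (v := 66049) (1) (Or.inl rfl) (by norm_num)
      (by norm_num) (by norm_num)
  · show parityBit 7 _ = 0
    exact parityBit_eq_of_eq 7 2 (u := 139392) (v := 66049) (1) (Or.inl rfl) (by norm_num)
      (by norm_num) (by norm_num)
  · show parityBit 17 _ = 0
    exact parityBit_eq_of_eq 17 0 (u := 6830208) (v := 66049) (1) (Or.inl rfl) (by norm_num)
      (by norm_num) (by norm_num)
  · show signBit _ = 1
    exact signBit_of_neg (by norm_num)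
  · show parityBit 17 _ = 0
    exact parityBit_eq_of_eq 17 0 (u := 1926688218) (v := 66049) (-1) (Or.inr rfl)
      (by norm_num) (by norm_num) (by norm_num)

end Points

/-- **`4 ≤ rank_ℤ E₂₉₂₇₄(ℚ)`** (Wiman 1945; Goldfeld 1976, p. 626 «has rank `4`» [sic, for the
emended curve]): the points `P₁, P₂, P₃, P₄` are `ℤ`-linearly independent, because under the
`2`-descent characters `ψ` the values `ψ(P₁), …, ψ(P₄), ψ(T₁), ψ(T₂)` are `𝔽₂`-independent
(`decide` on the `64` coefficient vectors) — Silverman AEC Prop. X.1.4, through the tree's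
`TwoDescentLocal.le_mordellWeilRank_of_twoTorsion'` (Mordell–Weil included).
[cite: SilvermanAEC2009, Prop. X.1.4] [cite: Goldfeld1976, p. 626] -/
theorem four_le_mordellWeilRank : 4 ≤ (E).mordellWeilRank := by
  refine le_mordellWeilRank_of_twoTorsion' hsplit ψ ![P₁, P₂, P₃, P₄] ?_ ?_
  · rw [ψ_T1, ψ_T2, ψ_T3]; decide
  · intro c ε₁ ε₂ hc
    simp only [Fin.sum_univ_succ, Fin.sum_univ_zero, Matrix.cons_val_zero, Matrix.cons_val_succ,
      ψ_P₁, ψ_P₂, ψ_P₃, ψ_P₄, ψ_T1, ψ_T2] at hc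
    revert hc ε₁ ε₂ c
    decide

end Literature.NumberTheory.EllipticCurves.CongruentNumber29274

end
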